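import Summits.BirchSwinnertonDyer.BirchSwinnertonDyer.Theorems.SylvesterTwoHeegnerIndexCMFlipReductionDatum
import Summits.BirchSwinnertonDyer.BirchSwinnertonDyer.Theorems.SylvesterTwoHeegnerIndexCMFlipLevelPrimePrep
import Summits.BirchSwinnertonDyer.BirchSwinnertonDyer.Theorems.SylvesterTwoHeegnerIndexCMFlipLevelPairPrep
import Summits.BirchSwinnertonDyer.BirchSwinnertonDyer.Theorems.SylvesterTwoHeegnerIndexCMDataPairRecipe
import Summits.BirchSwinnertonDyer.BirchSwinnertonDyer.Theorems.SylvesterTwoHeegnerIndexCMDataCoupledFrame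
import Summits.BirchSwinnertonDyer.Rank1Residual.X11b.KolyvaginH44OfEulerCongruence
import Literature.NumberTheory.EllipticCurves.KolyvaginClassFlipSupersingular
import Literature.NumberTheory.EllipticCurves.KolyvaginClassLocalConditionCoprimeIndex
import Literature.NumberTheory.EllipticCurves.HeegnerPointsKolyvaginPrimaryCebotarevProofs
import HarnessLib

/-!
# The COUPLED Cassels–Tate telescope, XXVII: THE FLIP WITH MULTIPLES at a general level `9p(ℓm)` of HSY's
# tower and a general `2`-power torsion level — k-ty1 #14 instantiated ONCE for both orientations (RESIDUE c v3
# (T-L1) l.87–98, core form)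

Crux `UpperOffV0HSYPlus` (stmt-BirchSwinnertonDyer-19804); rows' display RESIDUE c v3 (`…TailFourOfResidue`
p714972) l.87–98: for `Kol ℓ`, `ℓm ∈ KolSupp`, every `a`, `2^a • c_U(ℓm)` is Selmer at `λ ∋ ℓ` iff
`2^a • c_L(m) ∈ T_L(λ)` (`(U, L) = (A, B)` for `m` even, `(B, A)` for `m` odd), torsion level `2^κ·2^κ`.  This
file is the level-, conductor- and orientation-generic CORE of that clause in the shape of the tree's level-`2`
instances `flip_levelPrime` / `flip_levelPair` (conductors `9pℓ`, `9pℓℓ'`) — the SAME proof, ONE call of k-ty1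
#14 `JZero.zsmul_kolyvaginClass_cubicTwist_mem_selmerLocalKer_iff_mem_torsionLocalKer` — with: the conductor
`9·p·(ℓ·m)` for ANY `m ≠ 0` prime to `ℓ` (`inertia_package_pair`'s second "prime" is any natural); the torsion
level `nl = 2^M`, `M ≥ 1` (free `nl` + `hn : nl = 2 ^ M`), #14's multiple `k : ℤ` free (rows: `k = 2^a`); the
upper twist `E_{b₁}` (frame `(v₁, ψ₁, ρ)`) and lower twist `E_{b₂}` (`(v₂, ψ₂, ρ' = ρ ∘ ρ)`) GENERIC, their
curve-specific inputs (ellipticity, good reduction at `λ`, `N'` fixing `v₁, v₂`, `ℓ ∤ N(E_{b₂})`,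
`Frob_ℓ = Frob_∞` on `E_{b₂}[2^M]`) hypotheses; the points `κ⁻¹ ι(D_σ z)` / `κ⁻¹ ι(z₀)` for ANY
`z, z₀ ∈ W₀(K[9p(ℓm)])` (rows: `z = D_m y_{ℓm}`, `z₀ = D_m y_m`) subject to the two Euler-system inputs in
their USED form — `Σ_{i ≤ ℓ} σ^i z = 0` ((ES1) + `a_ℓ(E₉) = 0` through `D_m`) and the conjugate-wise
reduction congruence `red(g • ι z) = Frob_ℓ • red(g • ι z₀)` ((ES2), Nekovář 2007 Prop. 4.9, through `D_m`),
displayed as `htrz`, `hES`.  Level-`2^M` plumbing: `mem_torsionFixing_frame_of_cubicTwist` (`F` fixing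
`E_{b₂}[n]` and `v₂` fixes `W₀[n]`), `exists_frame_reductionDatum_pow` (#F0 at torsion level `2^M`: the generic
`SylvesterTwoUpper.exists_reductionDatum_of_frobeniusTrace_eq_zero` at `n = 2^M` + `JZero.exists_reduced_mulX_frame`).
* `mem_torsionFixing_frame_of_cubicTwist`, `exists_frame_reductionDatum_pow`, ★ `flip_core_sylvesterTower`.
Theorems only (no definition / named fact / instance / notation); nothing asserted on 19804; no stub closed;
X12.CMAtTwo NOT proved; BSD not claimed for any curve.  Sources: [GrossLMS1991] §3 (3.5), Prop. 3.7, §4,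
Prop. 6.2 (2); [McCallumLMS1991] Prop. 4.4, §4 (4)–(6); [Nekovar2007] Prop. 4.9, 4.13; [HuShuYin2019] §1–§2,
§4.1.  `lean search 'flip_core'` → nothing before this file; `maxHeartbeats 1600000` scoped to the #14 call
(~45 binders, as in `flip_levelPair`).
-/

set_option linter.dupNamespace false -- Summits modules are `Summit.<Summit>.<Problem>…` by design
set_option autoImplicit false

noncomputable section

open scoped Classical Pointwise
namespace Summit.BirchSwinnertonDyer.BirchSwinnertonDyer.Theorems.SylvesterTwoCMFlip

open WeierstrassCurve Field NumberField IsDedekindDomain Finset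
open Literature.NumberTheory.EllipticCurves Literature.NumberTheory.GaloisRepresentations
  Literature.NumberTheory.EllipticCurves.ModularForms
  Literature.NumberTheory.EllipticCurves.HuShuYin2019
  Literature.NumberTheory.EllipticCurves.KolyvaginCocycle
  Summit.BirchSwinnertonDyer.BirchSwinnertonDyer.Theorems.SylvesterTwoCMData
  Summit.BirchSwinnertonDyer.Rank1Residual.X11b
  Summit.BirchSwinnertonDyer.Rank1Residual.X11b.RingClassTower

variable {K : Type} [Field K] [NumberField K]

/-- An element of `Γ_K` fixing the `n`-torsion of a cubic twist `E_b(K̄) = ψ(E₉(K̄))` (cube root `v`) and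
fixing `v` fixes the `n`-torsion of the frame model `W₀(K̄) = κ(E₉(K̄))` (`ψ` is `Γ_{K(v)}`-equivariant,
`κ` is `Γ_K`-equivariant). [cite: HuShuYin2019, §2 p. 8] -/
theorem mem_torsionFixing_frame_of_cubicTwist {W₀ : WeierstrassCurve ℚ} {b : ℚ} {n : ℤ}
    (κ : geomPoints ((cubeSumCurve 9).baseChange K) ≃+ geomPoints (W₀.baseChange K))
    (hκG : ∀ (g : absoluteGaloisGroup K) (P : geomPoints ((cubeSumCurve 9).baseChange K)), κ (g • P) = g • κ P)
    {v : AlgebraicClosure K} {ψ : geomPoints ((cubeSumCurve 9).baseChange K) ≃+ geomPoints ((cubeSumCurve b).baseChange K)}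
    (hψ : ∀ {x y : AlgebraicClosure K}
      (h : (((cubeSumCurve 9).baseChange K).baseChange (AlgebraicClosure K)).toAffine.Nonsingular x y),
      ∃ h', ψ (Affine.Point.some x y h) = Affine.Point.some (v ^ 2 * x) (v ^ 3 * y) h')
    {F : absoluteGaloisGroup K} (hFv : (show AlgebraicClosure K ≃ₐ[K] AlgebraicClosure K from F) v = v)
    (hF : F ∈ torsionFixing ((cubeSumCurve b).baseChange K) n) :
    F ∈ torsionFixing (W₀.baseChange K) n := by
  rw [mem_torsionFixing_iff] at hF ⊢
  intro Q
  have hQn : n • (Q : geomPoints (W₀.baseChange K)) = 0 := (mem_geomTorsion_iff _ _ _).mp Q.2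
  have hPn : n • ψ (κ.symm Q) = 0 := by rw [← map_zsmul, ← map_zsmul, hQn, map_zero, map_zero]
  have h1 := congrArg Subtype.val (hF ⟨ψ (κ.symm Q), (mem_geomTorsion_iff _ _ _).mpr hPn⟩)
  change F • ψ (κ.symm Q) = ψ (κ.symm Q) at h1
  rw [← JZero.cubicTwist_smul_of_fix hψ hFv, ψ.apply_eq_iff_eq] at h1
  apply Subtype.ext
  change F • (Q : geomPoints (W₀.baseChange K)) = Q
  rw [← κ.apply_symm_apply Q, ← hκG, h1]

/-- **#F0 at the torsion level `2^M`**: the reduction datum of the CM frame `E₉` at a Kolyvagin prime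
`ℓ ≡ 2 (3)`, `ℓ ≠ 2`, `ℓ + 1 = 2^M l'`, in k-ty1 #14's binder shape — `SylvesterTwoCMFlip.exists_frame_reductionDatum`
with `2` replaced by `2^M` throughout (the arithmetic Frobenius `F` now required to fix `W₀[2^M]`): `red`
injective on `E₉[2^M]`, `φ² = 1` on `Ẽ₀[2^M]`, and the core `l' φ c = 0 ⟺ ∃ d, φ² d = d ∧ 2^M d = c`.
[cite: McCallumLMS1991, Prop. 4.4 (proof)] [cite: GrossLMS1991, Prop. 6.2 (2)] [cite: SilvermanAEC2009, Prop. VII.3.1(b)] -/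
theorem exists_frame_reductionDatum_pow [(⟨0, 0, 1, 0, -1⟩ : WeierstrassCurve ℚ).IsElliptic]
    [(⟨0, 0, 1, 0, -1⟩ : WeierstrassCurve ℚ).IsGloballyMinimal]
    {ℓ : ℕ} [Fact ℓ.Prime] (hℓ3 : ℓ % 3 = 2) (hℓ2 : ℓ ≠ 2)
    (hΔ : ¬ (ℓ : ℤ) ∣ minimalDiscriminantInt (⟨0, 0, 1, 0, -1⟩ : WeierstrassCurve ℚ))
    {M : ℕ} {l' : ℤ} (hl' : ((ℓ + 1 : ℕ) : ℤ) = (2 : ℤ) ^ M * l')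
    (κ : geomPoints ((cubeSumCurve 9).baseChange K) ≃+
      geomPoints ((⟨0, 0, 1, 0, -1⟩ : WeierstrassCurve ℚ).baseChange K))
    (hκG : ∀ (g : absoluteGaloisGroup K) (P : geomPoints ((cubeSumCurve 9).baseChange K)),
      κ (g • P) = g • κ P)
    {a b d : AlgebraicClosure K}
    (hκ : ∀ {x y : AlgebraicClosure K}
      (h : (((cubeSumCurve 9).baseChange K).baseChange (AlgebraicClosure K)).toAffine.Nonsingular x y),
      ∃ h', κ (.some x y h) = .some (a * x) (b * y + d) h')
    {v : AlgebraicClosure K} (hv : v ≠ 0)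
    (hv3 : ∀ g : absoluteGaloisGroup K,
      ((show AlgebraicClosure K ≃ₐ[K] AlgebraicClosure K from g) v) ^ 3 = v ^ 3)
    (ρ : absoluteGaloisGroup K →
      geomPoints ((cubeSumCurve 9).baseChange K) ≃+ geomPoints ((cubeSumCurve 9).baseChange K))
    (hρ : ∀ (g : absoluteGaloisGroup K) {x y : AlgebraicClosure K}
      (h : (((cubeSumCurve 9).baseChange K).baseChange (AlgebraicClosure K)).toAffine.Nonsingular x y),
      ∃ h', ρ g (Affine.Point.some x y h) =
        Affine.Point.some (((show AlgebraicClosure K ≃ₐ[K] AlgebraicClosure K from g) v / v) ^ 2 * x) y h')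
    {v₀ : HeightOneSpectrum (𝓞 K)} (hv₀ : (ℓ : 𝓞 K) ∈ v₀.asIdeal)
    (huniq : ∀ w : HeightOneSpectrum (𝓞 K), (ℓ : 𝓞 K) ∈ w.asIdeal → w = v₀)
    (hres : v₀.residueCard = ℓ ^ 2)
    {𝔓 : Ideal (absIntegers (𝓞 K) K)} (h𝔓 : 𝔓 ∈ v₀.primesAbove)
    {F : absoluteGaloisGroup K} (hF : IsArithFrobAt (𝓞 K) F 𝔓)
    (hFfix : F ∈ torsionFixing ((⟨0, 0, 1, 0, -1⟩ : WeierstrassCurve ℚ).baseChange K) ((2 ^ M : ℕ) : ℤ))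
    {φ₀ : absoluteGaloisGroup (ZMod ℓ)} (hφ₀ : ∀ x : AlgebraicClosure (ZMod ℓ), φ₀ • x = x ^ ℓ) :
    ∃ (g₀ : absoluteGaloisGroup K)
      (red : geomPoints ((cubeSumCurve 9).baseChange K) →+
        (reductionModPrime (⟨0, 0, 1, 0, -1⟩ : WeierstrassCurve ℚ) ℓ).geomPoints)
      (φ : (reductionModPrime (⟨0, 0, 1, 0, -1⟩ : WeierstrassCurve ℚ) ℓ).geomPoints →+
        (reductionModPrime (⟨0, 0, 1, 0, -1⟩ : WeierstrassCurve ℚ) ℓ).geomPoints)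
      (ρt : absoluteGaloisGroup K →
        (reductionModPrime (⟨0, 0, 1, 0, -1⟩ : WeierstrassCurve ℚ) ℓ).geomPoints →+
          (reductionModPrime (⟨0, 0, 1, 0, -1⟩ : WeierstrassCurve ℚ) ℓ).geomPoints),
      (∀ x, red x = geomReduction hΔ
          ((RatClosure.pointsEquiv (K := K) (⟨0, 0, 1, 0, -1⟩ : WeierstrassCurve ℚ)).symm (g₀⁻¹ • κ x))) ∧
      (∀ b, φ b = φ₀ • b) ∧
      (∀ (g : absoluteGaloisGroup K) (x : geomPoints ((cubeSumCurve 9).baseChange K)),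
        red (ρ g x) = ρt g (red x)) ∧
      (∀ (g : absoluteGaloisGroup K) b, ρt g (φ b) = φ (ρt g (ρt g b))) ∧
      (∀ τ ∈ 𝔓.inertia (absoluteGaloisGroup K), ∀ x, red (τ • x) = red x) ∧
      (∀ x, red (F • x) = φ (φ (red x))) ∧
      (∀ x, ((2 ^ M : ℕ) : ℤ) • x = 0 → red x = 0 → x = 0) ∧
      (∀ b, ((2 ^ M : ℕ) : ℤ) • b = 0 → φ (φ b) = b) ∧
      (∀ c, φ (φ c) = c → (l' • φ c = 0 ↔ ∃ d, φ (φ d) = d ∧ (((2 : ℕ) : ℤ) ^ M) • d = c)) := by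
  have hℓ : ℓ.Prime := Fact.out
  have ha0 : (⟨0, 0, 1, 0, -1⟩ : WeierstrassCurve ℚ).frobeniusTrace ℓ = 0 :=
    frobeniusTrace_sylvesterNineMinimal_eq_zero hℓ hℓ3 hℓ2
  have hℓ2M : ¬ ℓ ∣ 2 ^ M := fun h ↦
    hℓ2 ((Nat.prime_dvd_prime_iff_eq hℓ Nat.prime_two).mp (hℓ.dvd_of_dvd_pow h))
  -- the generic datum on the minimal model, at the torsion level `2^M`
  obtain ⟨g₀, red₀, φ, hred₀, hφ, hredI₀, hredF₀, hinj₀, hBn, hχ0⟩ :=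
    SylvesterTwoUpper.exists_reductionDatum_of_frobeniusTrace_eq_zero (K := K)
      (⟨0, 0, 1, 0, -1⟩ : WeierstrassCurve ℚ) hΔ (p := 2) (M := M) hl' ha0 hφ₀ hv₀ huniq hres h𝔓
      (n := 2 ^ M) hℓ2M (pow_ne_zero M two_ne_zero) hF hFfix
  -- the frame: `red = red₀ ∘ κ`, the reduced CM maps and the FLIP under Frobenius (k-ty1 #15)
  set red : geomPoints ((cubeSumCurve 9).baseChange K) →+
      (reductionModPrime (⟨0, 0, 1, 0, -1⟩ : WeierstrassCurve ℚ) ℓ).geomPoints :=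
    red₀.comp κ.toAddMonoidHom with hred_def
  have hred : ∀ x, red x = red₀ (κ x) := fun _ ↦ rfl
  have hc : ∀ g : absoluteGaloisGroup K,
      (((show AlgebraicClosure K ≃ₐ[K] AlgebraicClosure K from g) v / v) ^ 2) ^ 3 = 1 := by
    intro g
    rw [← pow_mul, show 2 * 3 = 3 * 2 from rfl, pow_mul, div_pow, hv3 g, div_self (pow_ne_zero 3 hv),
      one_pow]
  obtain ⟨ρt, hredρ, hφρ, hredI, hredF, hinj⟩ :=
    JZero.exists_reduced_mulX_frame hΔ rfl rfl rfl hℓ3 κ hκG hκ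
      (c := fun g : absoluteGaloisGroup K ↦
        ((show AlgebraicClosure K ≃ₐ[K] AlgebraicClosure K from g) v / v) ^ 2)
      hc ρ (fun g _ _ h ↦ hρ g h) g₀ hred₀ hφ₀ hφ (I := 𝔓.inertia (absoluteGaloisGroup K)) hredI₀
      hredF₀ hinj₀ hred
  have hχ : ∀ c : (reductionModPrime (⟨0, 0, 1, 0, -1⟩ : WeierstrassCurve ℚ) ℓ).geomPoints,
      φ (φ c) = c → (l' • φ c = 0 ↔ ∃ d, φ (φ d) = d ∧ (((2 : ℕ) : ℤ) ^ M) • d = c) := fun c hc' ↦ by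
    rw [← hχ0 c hc', zero_smul, zero_sub, neg_eq_zero]
  exact ⟨g₀, red, φ, ρt, fun x ↦ by rw [hred, hred₀], hφ, hredρ, hφρ, hredI, hredF, hinj, hBn, hχ⟩


set_option maxHeartbeats 1600000 in
/-- ★ **THE FLIP WITH MULTIPLES at the level `9p(ℓm)`, torsion level `2^M` — CORE** (module docstring):
k-ty1 #14 for the frame `E₉` with an upper cubic twist `E_{b₁}` (cube root `v₁`, transport `ψ₁`, CM family
`ρ`) and a lower one `E_{b₂}` (`v₂`, `ψ₂`, `ρ' = ρ ∘ ρ`), an embedded `K[9p(ℓm)]` (`emb`, fixer `N`, the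
`K[9p]`-fixer `N'` fixing `v₁, v₂`, representatives `t`), a generator `σ` of `Gal(K[9p(ℓm)]/K[9pm])`, and two
points `z, z₀ ∈ W₀(K[9p(ℓm)])` with `Σ_{i ≤ ℓ} σ^i z = 0` and the conjugate-wise reduction congruence
`red(g • ι z) = Frob_ℓ • red(g • ι z₀)`: at the place `λ ∋ ℓ` (`ℓ ≡ 2 (3)` a Kolyvagin prime of `E_{b₂}` at
the level `2^M`, good for both twists), GRANTED «every arithmetic Frobenius above `λ` fixes `κ⁻¹ ι z₀`» and the
Selmer condition of the lower class at `λ`, **for every `k : ℤ`, `k • c(ψ₁ (κ⁻¹ ι D_σ z)^χ)` is Selmer at `λ`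
iff `k • c(ψ₂ (κ⁻¹ ι z₀)^{χ'}) ∈ T_{E_{b₂}}(λ)`** at the torsion level `nl = 2^M`.
[cite: GrossLMS1991, §3 (3.5), Prop. 3.7, Prop. 6.2 (2), §4] [cite: McCallumLMS1991, Prop. 4.4, §4 (4)–(6)]
[cite: HuShuYin2019, §1 p. 4, §2 Prop. 2.4, §4.1] [cite: Nekovar2007, Prop. 4.9, Prop. 4.13 (ii)] -/
theorem flip_core_sylvesterTower {ω : K} (hω : ω ^ 2 + ω + 1 = 0) (h2 : Module.finrank ℚ K = 2)
    (ι : K →+* ℂ) [(⟨0, 0, 1, 0, -1⟩ : WeierstrassCurve ℚ).IsElliptic] [(⟨0, 0, 1, 0, -1⟩ : WeierstrassCurve ℚ).IsGloballyMinimal]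
    {b₁ b₂ : ℚ} [((cubeSumCurve b₁).baseChange K).IsElliptic] [((cubeSumCurve b₂).baseChange K).IsElliptic]
    [(cubeSumCurve b₂).IsElliptic]
    {p ℓ m : ℕ} (hp : p.Prime) [Fact ℓ.Prime] (hℓ3 : ℓ % 3 = 2) (hℓ2 : ℓ ≠ 2) (hℓp : ¬ ℓ ∣ p)
    (hm : m ≠ 0) (hℓm : ¬ ℓ ∣ m)
    (hℓ₂ : ¬ ℓ ∣ (cubeSumCurve b₂).conductorNorm ℤ) (hℓdK : ¬ ((ℓ : ℤ) ∣ NumberField.discr K))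
    {M : ℕ} (hM : 1 ≤ M) (nl : ℕ) (hn : nl = 2 ^ M) (hFrob₂ : FrobEqFrobInfty (cubeSumCurve b₂) K nl ℓ)
    (hΔ : ¬ (ℓ : ℤ) ∣ minimalDiscriminantInt (⟨0, 0, 1, 0, -1⟩ : WeierstrassCurve ℚ))
    -- the frame transport `E₉(K̄) ≃+ W₀(K̄)`
    (κ : geomPoints ((cubeSumCurve 9).baseChange K) ≃+ geomPoints ((⟨0, 0, 1, 0, -1⟩ : WeierstrassCurve ℚ).baseChange K))
    (hκG : ∀ (g : absoluteGaloisGroup K) (P : geomPoints ((cubeSumCurve 9).baseChange K)), κ (g • P) = g • κ P)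
    {a b d : AlgebraicClosure K}
    (hκ : ∀ {x y : AlgebraicClosure K}
      (h : (((cubeSumCurve 9).baseChange K).baseChange (AlgebraicClosure K)).toAffine.Nonsingular x y),
      ∃ h', κ (.some x y h) = .some (a * x) (b * y + d) h')
    -- the two cubic-twist frames
    {v₁ v₂ : AlgebraicClosure K} (hv₁ : v₁ ≠ 0) (hv₂ : v₂ ≠ 0)
    (hv₁3 : ∀ g : absoluteGaloisGroup K, ((show AlgebraicClosure K ≃ₐ[K] AlgebraicClosure K from g) v₁) ^ 3 = v₁ ^ 3)
    (hv₂3 : ∀ g : absoluteGaloisGroup K, ((show AlgebraicClosure K ≃ₐ[K] AlgebraicClosure K from g) v₂) ^ 3 = v₂ ^ 3)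
    {ψ₁ : geomPoints ((cubeSumCurve 9).baseChange K) ≃+ geomPoints ((cubeSumCurve b₁).baseChange K)}
    {ψ₂ : geomPoints ((cubeSumCurve 9).baseChange K) ≃+ geomPoints ((cubeSumCurve b₂).baseChange K)}
    (hψ₁ : ∀ {x y : AlgebraicClosure K}
      (h : (((cubeSumCurve 9).baseChange K).baseChange (AlgebraicClosure K)).toAffine.Nonsingular x y),
      ∃ h', ψ₁ (Affine.Point.some x y h) = Affine.Point.some (v₁ ^ 2 * x) (v₁ ^ 3 * y) h')
    (hψ₂ : ∀ {x y : AlgebraicClosure K}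
      (h : (((cubeSumCurve 9).baseChange K).baseChange (AlgebraicClosure K)).toAffine.Nonsingular x y),
      ∃ h', ψ₂ (Affine.Point.some x y h) = Affine.Point.some (v₂ ^ 2 * x) (v₂ ^ 3 * y) h')
    {ρ ρ' : absoluteGaloisGroup K → geomPoints ((cubeSumCurve 9).baseChange K) ≃+ geomPoints ((cubeSumCurve 9).baseChange K)}
    (hρ : ∀ (g : absoluteGaloisGroup K) {x y : AlgebraicClosure K}
        (h : (((cubeSumCurve 9).baseChange K).baseChange (AlgebraicClosure K)).toAffine.Nonsingular x y),
        ∃ h', ρ g (Affine.Point.some x y h) =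
          Affine.Point.some (((show AlgebraicClosure K ≃ₐ[K] AlgebraicClosure K from g) v₁ / v₁) ^ 2 * x) y h')
    (hρ₂ : ∀ (g : absoluteGaloisGroup K) {x y : AlgebraicClosure K}
        (h : (((cubeSumCurve 9).baseChange K).baseChange (AlgebraicClosure K)).toAffine.Nonsingular x y),
        ∃ h', ρ' g (Affine.Point.some x y h) =
          Affine.Point.some (((show AlgebraicClosure K ≃ₐ[K] AlgebraicClosure K from g) v₂ / v₂) ^ 2 * x) y h')
    (hρ' : ∀ (g : absoluteGaloisGroup K) (x : geomPoints ((cubeSumCurve 9).baseChange K)), ρ' g x = ρ g (ρ g x))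
    (hlaw₂ : ∀ (g : absoluteGaloisGroup K) (P : geomPoints ((cubeSumCurve 9).baseChange K)),
        g • ψ₂ P = ψ₂ (ρ' g (g • P)))
    (hρcomm : ∀ (g h : absoluteGaloisGroup K) (P : geomPoints ((cubeSumCurve 9).baseChange K)),
        h • ρ g P = ρ g (h • P))
    -- the level `K[9p(ℓm)]`: embedding, fixer, the `K[9p]`-fixer (fixing both cube roots), representatives
    (emb : ringClassField K ι (9 * p * (ℓ * m)) →+* AlgebraicClosure K)
    (hemb : ∀ k : K, emb (algebraMap K (ringClassField K ι (9 * p * (ℓ * m))) k) = algebraMap K (AlgebraicClosure K) k)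
    (ιe : letI : DecidableEq (ringClassField K ι (9 * p * (ℓ * m))) := fun a b ↦ Classical.propDecidable (a = b)
      ((⟨0, 0, 1, 0, -1⟩ : WeierstrassCurve ℚ).baseChange (ringClassField K ι (9 * p * (ℓ * m)))).toAffine.Point →+ geomPoints ((⟨0, 0, 1, 0, -1⟩ : WeierstrassCurve ℚ).baseChange K))
    (hιe : ∀ P, ιe P = Affine.Point.map (W' := (⟨0, 0, 1, 0, -1⟩ : WeierstrassCurve ℚ)) emb.toRatAlgHom P)
    (N : Subgroup (absoluteGaloisGroup K))
    (hN : ∀ g : absoluteGaloisGroup K, g ∈ N ↔ ∀ x : ringClassField K ι (9 * p * (ℓ * m)), (show AlgebraicClosure K ≃ₐ[K] AlgebraicClosure K from g) (emb x) = emb x)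
    (N' : Subgroup (absoluteGaloisGroup K))
    (hN' : ∀ g : absoluteGaloisGroup K, g ∈ N' ↔
      ∀ x ∈ {x : ringClassField K ι (9 * p * (ℓ * m)) | (x : ℂ) ∈ ringClassField K ι (9 * p)}, (show AlgebraicClosure K ≃ₐ[K] AlgebraicClosure K from g) (emb x) = emb x)
    (hN'v₁ : ∀ h ∈ N', (show AlgebraicClosure K ≃ₐ[K] AlgebraicClosure K from h) v₁ = v₁) (hN'v₂ : ∀ h ∈ N', (show AlgebraicClosure K ≃ₐ[K] AlgebraicClosure K from h) v₂ = v₂)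
    {ιt : Type} [Fintype ιt] (t : ιt → absoluteGaloisGroup K)
    -- the generator of `Gal(K[9p(ℓm)]/K[9pm])` and the two points with their Euler-system inputs
    {σ : ringClassField K ι (9 * p * (ℓ * m)) ≃ₐ[ℚ] ringClassField K ι (9 * p * (ℓ * m))}
    (hσ : Subgroup.zpowers σ = ringClassGalOver ι (9 * p * (ℓ * m)) (9 * p * m))
    {z z₀ : ((⟨0, 0, 1, 0, -1⟩ : WeierstrassCurve ℚ).baseChange (ringClassField K ι (9 * p * (ℓ * m)))).toAffine.Point}
    (htrz : ∑ i ∈ Finset.range (ℓ + 1), pointGalHom (⟨0, 0, 1, 0, -1⟩ : WeierstrassCurve ℚ) (ringClassField K ι (9 * p * (ℓ * m))) (σ ^ i) z = 0)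
    (hES : ∀ (φ₀ : absoluteGaloisGroup (ZMod ℓ)), (∀ x : AlgebraicClosure (ZMod ℓ), φ₀ • x = x ^ ℓ) →
      ∀ g : absoluteGaloisGroup K,
        geomReduction hΔ ((RatClosure.pointsEquiv (K := K) (⟨0, 0, 1, 0, -1⟩ : WeierstrassCurve ℚ)).symm (g • ιe z)) =
          φ₀ • geomReduction hΔ ((RatClosure.pointsEquiv (K := K) (⟨0, 0, 1, 0, -1⟩ : WeierstrassCurve ℚ)).symm (g • ιe z₀)))
    -- the classes' admissibility / invariance inputs
    {hdiv₁ : ∀ P : geomPoints ((cubeSumCurve b₁).baseChange K),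
      ∃ R : geomPoints ((cubeSumCurve b₁).baseChange K), ((nl : ℕ) : ℤ) • R = P}
    {hdiv₂ : ∀ P : geomPoints ((cubeSumCurve b₂).baseChange K),
      ∃ R : geomPoints ((cubeSumCurve b₂).baseChange K), ((nl : ℕ) : ℤ) • R = P}
    (hA₁ : IsAdmissible (absoluteGaloisGroup K)
      ((FixedPoints.addSubgroup N (geomPoints ((cubeSumCurve 9).baseChange K))).map ψ₁.toAddMonoidHom) ((nl : ℕ) : ℤ))
    (hA₂ : IsAdmissible (absoluteGaloisGroup K)
      ((FixedPoints.addSubgroup N (geomPoints ((cubeSumCurve 9).baseChange K))).map ψ₂.toAddMonoidHom) ((nl : ℕ) : ℤ))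
    (hP₁ : ψ₁ (∑ i, ρ (t i) (t i • κ.symm (ιe (KolyvaginOperator.derivOp (pointGalHom (⟨0, 0, 1, 0, -1⟩ : WeierstrassCurve ℚ) (ringClassField K ι (9 * p * (ℓ * m)))) σ ℓ z)))) ∈
      invPoints (absoluteGaloisGroup K)
        ((FixedPoints.addSubgroup N (geomPoints ((cubeSumCurve 9).baseChange K))).map ψ₁.toAddMonoidHom) ((nl : ℕ) : ℤ))
    (hP₂ : ψ₂ (∑ i, ρ' (t i) (t i • κ.symm (ιe z₀))) ∈
      invPoints (absoluteGaloisGroup K)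
        ((FixedPoints.addSubgroup N (geomPoints ((cubeSumCurve 9).baseChange K))).map ψ₂.toAddMonoidHom) ((nl : ℕ) : ℤ))
    -- the place, good for both twists, and the displayed inputs about `κ⁻¹ ι z₀` at `λ`
    (v : HeightOneSpectrum (𝓞 K)) (hv : (ℓ : 𝓞 K) ∈ v.asIdeal)
    (hgood₁ : ((cubeSumCurve b₁).baseChange K).HasGoodReductionAt v)
    (hgood₂ : ((cubeSumCurve b₂).baseChange K).HasGoodReductionAt v)
    (hPmFrob : ∀ 𝔓 ∈ v.primesAbove, ∀ F : absoluteGaloisGroup K, IsArithFrobAt (𝓞 K) F 𝔓 → F • κ.symm (ιe z₀) = κ.symm (ιe z₀))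
    (hsel₂ : kolyvaginClass ((cubeSumCurve b₂).baseChange K) ((nl : ℕ) : ℤ) hdiv₂ hA₂
      (ψ₂ (∑ i, ρ' (t i) (t i • κ.symm (ιe z₀)))) hP₂ ∈
      selmerLocalKer ((cubeSumCurve b₂).baseChange K) (v.adicCompletion K) ((nl : ℕ) : ℤ))
    (k : ℤ) :
    k • kolyvaginClass ((cubeSumCurve b₁).baseChange K) ((nl : ℕ) : ℤ) hdiv₁ hA₁
        (ψ₁ (∑ i, ρ (t i) (t i • κ.symm (ιe (KolyvaginOperator.derivOp (pointGalHom (⟨0, 0, 1, 0, -1⟩ : WeierstrassCurve ℚ) (ringClassField K ι (9 * p * (ℓ * m)))) σ ℓ z))))) hP₁ ∈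
        selmerLocalKer ((cubeSumCurve b₁).baseChange K) (v.adicCompletion K) ((nl : ℕ) : ℤ) ↔
      k • kolyvaginClass ((cubeSumCurve b₂).baseChange K) ((nl : ℕ) : ℤ) hdiv₂ hA₂
          (ψ₂ (∑ i, ρ' (t i) (t i • κ.symm (ιe z₀)))) hP₂ ∈
        ((cubeSumCurve b₂).baseChange K).torsionLocalKer (v.adicCompletion K) ((nl : ℕ) : ℤ) := by
  subst hn
  have hℓ : ℓ.Prime := Fact.out
  have hK := JZero.isImaginaryQuadratic_of_sq_add_self_add_one hω h2
  have hinert := JZero.span_natCast_isPrime_of_mod_three_eq_two hω h2 hℓ hℓ3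
  have hp0 : p ≠ 0 := hp.ne_zero
  have hℓ3' : ℓ ≠ 3 := by rintro rfl; simp at hℓ3
  have hf : 9 * p ≠ 0 := mul_ne_zero (by norm_num) hp0
  have hfm : 9 * p * m ≠ 0 := mul_ne_zero hf hm
  have hℓfm : ¬ ℓ ∣ 9 * p * m := by
    rw [show 9 * p * m = 3 ^ 2 * (p * m) by ring]
    intro h
    rcases (Nat.Prime.dvd_mul hℓ).mp h with h9 | hpm
    · exact hℓ3' ((Nat.prime_dvd_prime_iff_eq hℓ Nat.prime_three).mp (hℓ.dvd_of_dvd_pow h9))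
    · rcases (Nat.Prime.dvd_mul hℓ).mp hpm with h' | h'
      · exact hℓp h'
      · exact hℓm h'
  have hn0 : 9 * p * (ℓ * m) ≠ 0 := mul_ne_zero hf (mul_ne_zero hℓ.ne_zero hm)
  obtain ⟨_, _⟩ := finiteDimensional_and_isGalois_ringClassField hK ι hn0
  haveI hNn : N.Normal := normal_of_mem_iff emb hemb N hN
  have hNN' : N ≤ N' := le_of_mem_iff_of_mem_iff_forall emb hN hN'
  have hcomm := commutator_mem_of_ringClassField hK ι hn0 emb hemb N hN
  have hNv₁ : ∀ h ∈ N, (show AlgebraicClosure K ≃ₐ[K] AlgebraicClosure K from h) v₁ = v₁ := fun h hh ↦ hN'v₁ h (hNN' hh)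
  have hKol₂ : IsKolyvaginPrime ((cubeSumCurve b₂).conductorNorm ℤ) (cubeSumCurve b₂) K 2 ℓ :=
    ⟨hℓ, hℓ₂, hℓdK, hℓ2, hinert, FrobEqFrobInfty.of_dvd (W := cubeSumCurve b₂) (K := K) (dvd_pow_self 2 (by omega)) hFrob₂⟩
  have hvpl : v = hKol₂.place := hKol₂.mem_iff.mp hv
  have huniq : ∀ w : HeightOneSpectrum (𝓞 K), (ℓ : 𝓞 K) ∈ w.asIdeal → w = v :=
    fun w hw ↦ (hKol₂.mem_iff.mp hw).trans hvpl.symm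
  have hres : v.residueCard = ℓ ^ 2 := by rw [hvpl]; exact KolyvaginH44.residueCard_place_eq_sq hK hKol₂
  haveI : CharZero (v.adicCompletion K) :=
    charZero_of_injective_algebraMap (algebraMap K (v.adicCompletion K)).injective
  obtain ⟨𝔐, h𝔐⟩ := v.localPrimesAbove_nonempty
  have h𝔓 : v.primeBelow (closureEmb (K := K) (v.adicCompletion K)) 𝔐 ∈ v.primesAbove :=
    HeightOneSpectrum.primeBelow_mem_primesAbove h𝔐
  have h𝔔 : v.primeBelow (closureEmb (K := K) (v.adicCompletion K)) 𝔐 ∈ hKol₂.place.primesAbove := by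
    rw [← hvpl]; exact h𝔓
  obtain ⟨F, hF, hFfix⟩ := exists_isArithFrobAt_mem_torsionFixing (cubeSumCurve b₂) hK hKol₂ hFrob₂ h𝔔
  have hsurj := (torsionPointsMap_bijective ((cubeSumCurve b₂).baseChange K) (v.adicCompletion K)
    (pow_ne_zero M two_ne_zero : (2 ^ M : ℕ) ≠ 0)).2
  have h2v : ((2 : ℕ) : 𝓞 K) ∉ v.asIdeal := not_natCast_mem_of_prime_ne hℓ Nat.prime_two hℓ2 v hv
  obtain ⟨⟨τ₀, hτ₀, hτ₀σ, hI⟩, hIN'', hFN''⟩ := inertia_package_pair hK ι hfm hℓ hℓfm hv hinert emb hemb h𝔓 hσ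
    N hN N' hN' (geomPoints ((cubeSumCurve b₁).baseChange K))
  have hFmem : F ∈ N' := hFN'' F hF
  have hFv₂ : (show AlgebraicClosure K ≃ₐ[K] AlgebraicClosure K from F) v₂ = v₂ := hN'v₂ F hFmem
  have hIv₁ : ∀ τ ∈ (v.primeBelow (closureEmb (K := K) (v.adicCompletion K)) 𝔐).inertia
      (absoluteGaloisGroup K), (show AlgebraicClosure K ≃ₐ[K] AlgebraicClosure K from τ) v₁ = v₁ :=
    fun τ hτ ↦ hN'v₁ τ (hIN'' τ hτ)
  have hFfix₀ := mem_torsionFixing_frame_of_cubicTwist κ hκG hψ₂ hFv₂ hFfix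
  obtain ⟨φ₀, hφ₀'⟩ := exists_frobenius_absoluteGaloisGroup (ZMod ℓ)
  have hφ₀ : ∀ x : AlgebraicClosure (ZMod ℓ), φ₀ • x = x ^ ℓ := fun x ↦ by rw [hφ₀' x, Nat.card_zmod]
  obtain ⟨-, l', hl'⟩ := IsKolyvaginPrime.pow_dvd_add_one (cubeSumCurve b₂) Nat.prime_two hKol₂ hM hFrob₂
  obtain ⟨g₀, red, φ, ρt, hredg, hφ, hredρ, hφρ, hredI, hredF, hinj, hBn, hχ⟩ :=
    exists_frame_reductionDatum_pow (K := K) hℓ3 hℓ2 hΔ hl' κ hκG hκ hv₁ hv₁3 ρ hρ hv huniq hres h𝔓 hF hFfix₀ hφ₀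
  have hκs : ∀ (g : absoluteGaloisGroup K) (Q : geomPoints ((⟨0, 0, 1, 0, -1⟩ : WeierstrassCurve ℚ).baseChange K)),
      κ.symm (g • Q) = g • κ.symm Q := fun g Q ↦ by
    apply κ.injective
    rw [hκG, κ.apply_symm_apply, κ.apply_symm_apply]
  have hPnN' : ∀ h ∈ N, h • κ.symm (ιe (KolyvaginOperator.derivOp (pointGalHom (⟨0, 0, 1, 0, -1⟩ : WeierstrassCurve ℚ) (ringClassField K ι (9 * p * (ℓ * m)))) σ ℓ z)) = κ.symm (ιe (KolyvaginOperator.derivOp (pointGalHom (⟨0, 0, 1, 0, -1⟩ : WeierstrassCurve ℚ) (ringClassField K ι (9 * p * (ℓ * m)))) σ ℓ z)) :=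
    (JZero.mem_fixedPoints_iff _ N _).mp (mem_fixedPoints_symm_of_equivariant κ hκG N
      (map_emb_mem_fixedPoints (⟨0, 0, 1, 0, -1⟩ : WeierstrassCurve ℚ) ι emb ιe hιe N hN _))
  have hPmN : ∀ h ∈ N, h • κ.symm (ιe z₀) = κ.symm (ιe z₀) :=
    (JZero.mem_fixedPoints_iff _ N _).mp (mem_fixedPoints_symm_of_equivariant κ hκG N
      (map_emb_mem_fixedPoints (⟨0, 0, 1, 0, -1⟩ : WeierstrassCurve ℚ) ι emb ιe hιe N hN _))
  have hIτ₀ : ∀ τ ∈ (v.primeBelow (closureEmb (K := K) (v.adicCompletion K)) 𝔐).inertia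
      (absoluteGaloisGroup K), ∃ i : ℕ,
      ∀ x ∈ (FixedPoints.addSubgroup N (geomPoints ((cubeSumCurve 9).baseChange K))).map
        ψ₁.toAddMonoidHom, τ • x = (τ₀ ^ i) • x := by
    intro τ hτ
    obtain ⟨i, -, hi⟩ := hI τ hτ
    refine ⟨i, fun x hx ↦ hi x ?_⟩
    obtain ⟨w, hw, rfl⟩ := hx
    exact (JZero.forall_smul_cubicTwist_eq_iff hψ₁ (N := (N : Set (absoluteGaloisGroup K))) hNv₁ w).mpr
      ((JZero.mem_fixedPoints_iff _ N _).mp hw)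
  have hunits : 2 ≤ 9 * p * m ∨ NumberField.discr K < -4 := by
    left
    have h1 : 1 ≤ p * m := Nat.one_le_iff_ne_zero.mpr (mul_ne_zero hp0 hm)
    have h2' : 9 * p * m = 9 * (p * m) := by ring
    omega
  have hdivℓ : 9 * p * (ℓ * m) / ℓ = 9 * p * m := by
    rw [show 9 * p * (ℓ * m) = 9 * p * m * ℓ by ring, Nat.mul_div_cancel _ hℓ.pos]
  have hordσ : orderOf σ = ℓ + 1 :=
    orderOf_eq_succ_of_zpowers_eq_ringClassGalOver hK ι hℓ hinert ⟨9 * p * m, by ring⟩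
      (by rw [hdivℓ]; exact hℓfm) hn0 (by rw [hdivℓ]; exact hunits) (by rw [hdivℓ]; exact hσ)
  have hDσ := pointGalHom_derivOp_sub_eq_of_trace_eq_zero (⟨0, 0, 1, 0, -1⟩ : WeierstrassCurve ℚ) (σ := σ) (ℓ := ℓ) (z := z)
    (by rw [← hordσ, pow_orderOf_eq_one]) htrz
  have hτ₀D : τ₀ • κ.symm (ιe (KolyvaginOperator.derivOp (pointGalHom (⟨0, 0, 1, 0, -1⟩ : WeierstrassCurve ℚ) (ringClassField K ι (9 * p * (ℓ * m)))) σ ℓ z)) - κ.symm (ιe (KolyvaginOperator.derivOp (pointGalHom (⟨0, 0, 1, 0, -1⟩ : WeierstrassCurve ℚ) (ringClassField K ι (9 * p * (ℓ * m)))) σ ℓ z)) = ((ℓ + 1 : ℕ) : ℤ) • κ.symm (ιe z) := by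
    rw [← hκs, ← map_sub κ.symm, ← map_zsmul κ.symm]
    congr 1
    exact smul_embPoints_sub_eq_zsmul (⟨0, 0, 1, 0, -1⟩ : WeierstrassCurve ℚ) emb ιe hιe τ₀ σ hτ₀σ (by convert hDσ)
  have hR : ((2 ^ M : ℕ) : ℤ) • (l' • κ.symm (ιe z)) = τ₀ • κ.symm (ιe (KolyvaginOperator.derivOp (pointGalHom (⟨0, 0, 1, 0, -1⟩ : WeierstrassCurve ℚ) (ringClassField K ι (9 * p * (ℓ * m)))) σ ℓ z)) - κ.symm (ιe (KolyvaginOperator.derivOp (pointGalHom (⟨0, 0, 1, 0, -1⟩ : WeierstrassCurve ℚ) (ringClassField K ι (9 * p * (ℓ * m)))) σ ℓ z)) := by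
    rw [hτ₀D, smul_smul, hl']
    push_cast
    ring_nf
  have hRN : l' • κ.symm (ιe z) ∈ FixedPoints.addSubgroup N (geomPoints ((cubeSumCurve 9).baseChange K)) :=
    AddSubgroup.zsmul_mem _ (mem_fixedPoints_symm_of_equivariant κ hκG N
      (map_emb_mem_fixedPoints (⟨0, 0, 1, 0, -1⟩ : WeierstrassCurve ℚ) ι emb ιe hιe N hN _)) l'
  have hRA : ψ₁ (∑ i, ρ (t i) (t i • (l' • κ.symm (ιe z)))) ∈
      (FixedPoints.addSubgroup N (geomPoints ((cubeSumCurve 9).baseChange K))).map ψ₁.toAddMonoidHom := by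
    refine ⟨_, ?_, rfl⟩
    exact KolyvaginCocycle.chiComponent_mem (fun g ↦ (ρ g).toAddMonoidHom)
      (fun g _ ha ↦ JZero.smul_mem_fixedPoints _ N g ha)
      (fun g _ ha ↦ JZero.rho_mem_fixedPoints _ hω hv₁ hv₁3 hρ N g ha) t hRN
  have hRred : ∀ i, red (t i • (l' • κ.symm (ιe z))) = l' • φ (red (t i • κ.symm (ιe z₀))) := by
    intro i
    rw [KolyvaginCocycle.smul_zsmul_comm, map_zsmul, hredg, hredg, ← hκs, ← hκs, κ.apply_symm_apply,
      κ.apply_symm_apply, ← mul_smul, ← mul_smul, hφ]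
    congr 1
    exact hES φ₀ hφ₀ (g₀⁻¹ * t i)
  have hFP₂ : F • ψ₂ (∑ i, ρ' (t i) (t i • κ.symm (ιe z₀))) = ψ₂ (∑ i, ρ' (t i) (t i • κ.symm (ιe z₀))) := by
    have h1 : F • (∑ i, ρ' (t i) (t i • κ.symm (ιe z₀))) = ∑ i, ρ' (t i) (t i • κ.symm (ιe z₀)) :=
      JZero.smul_chiComponent_eq_self hω hv₂ hv₂3 hρ₂ N hcomm t hPmN (hPmFrob _ h𝔓 F hF)
    have h2' : ∀ Q : geomPoints ((cubeSumCurve 9).baseChange K), ρ' F Q = Q :=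
      fun Q ↦ JZero.rho_apply_of_apply_eq hv₂ hρ₂ hFv₂ Q
    rw [hlaw₂, h1, h2']
  exact JZero.zsmul_kolyvaginClass_cubicTwist_mem_selmerLocalKer_iff_mem_torsionLocalKer
    (W := (cubeSumCurve 9).baseChange K) (W₁ := (cubeSumCurve b₁).baseChange K)
    (W₂ := (cubeSumCurve b₂).baseChange K) Nat.prime_two (M := M) hψ₁ hψ₂
    ρ ρ' hρ' hρcomm N hcomm t hPnN' (hdiv₁ := hdiv₁) (hdiv₂ := hdiv₂)
    hA₁ hA₂ hP₁ hP₂ hgood₁ hgood₂ h2v h𝔐 hF hFfix hsurj hFv₂ hIv₁ red φ ρt hredρ hφρ hredI hredF hinj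
    hBn hχ hτ₀ hIτ₀ hR hRA hRred hFP₂ hsel₂ k

end Summit.BirchSwinnertonDyer.BirchSwinnertonDyer.Theorems.SylvesterTwoCMFlip

end
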